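import Literature.AlgebraicGeometry.ShimuraVarieties.UnitaryAuxiliaryTorusDatumExt
import Literature.AlgebraicGeometry.ShimuraVarieties.UnitaryAuxiliaryCanonicalModelPrinted
import Literature.AlgebraicGeometry.ShimuraVarieties.UnitaryAuxiliaryTorusReflexNorm
import HarnessLib

/-!
# F1 retires: `Aux.canonicalModel_exists_printed` is the instance `M = L`, `j = id`, `E = E♯(Φ)` of the twisted fact

Layer `Literature/AlgebraicGeometry/ShimuraVarieties`, namespace `UnitaryCanonicalModel.Aux`.  ONE THEOREM (no named fact, no
instance, no notation): the named fact F1 `Aux.canonicalModel_exists_printed` of `UnitaryAuxiliaryCanonicalModelPrinted` (Deligne 2.3.1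
with 2.2.5 read on the auxiliary Hodge-type datum `(Res U(H) × T₀(L), X × {h_Φ})` over `E♯(Φ) = τ(L)·E*(Φ)`) FOLLOWS from the
`(M, j, Φ, E)`-parametrised fact `Aux.canonicalModel_exists_ext_printed` of `UnitaryAuxiliaryTorusDatumExt` (hDel cut v12 «K-twist») at
`M = L`, `j = RingHom.id L`, `E = Aux.reflexField L Φ τ`: the carriers agree definitionally (`complexSystemExt_self`,
`isCanonicalDescentAtExt_self_iff`), `IsExtAdapted τ id Φ ↔ IsAdapted L Φ τ` (`isExtAdapted_id_iff`), `τ(L) ⊆ E♯(Φ)`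
(`apply_mem_reflexField`) and `E*(Φ) ≤ E♯(Φ)` (`traceField_le_reflexField`).  Consumers of `(hF1 : Aux.canonicalModel_exists_printed)`
are fed `canonicalModel_exists_printed_of_ext hExt`; the cell's fact count drops by one when F1's remaining users migrate.

## References

* P. Deligne, *Variétés de Shimura: interprétation modulaire…* (Corvallis 1979), 2.2.4–2.2.5, Criterion 2.3.1, 2.3.9–2.3.10
  (Milne's translation PDF pp. 29, 32). [Deligne1979ShimuraVarieties]
* J. S. Milne, *Introduction to Shimura Varieties* (2005), Def. 12.8 (62) p. 114, Rem. 12.9, §14. [Milne2005ShimuraVarieties]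
* Y. Liu, *Fourier–Jacobi cycles and arithmetic relative trace formula* (2021), App. C §C.3 (Lem. C.14, (C.6)). [Liu2021]

## Provenance

hodgecm-mathlib cell, typer seat B-typ03 executing B-typ04's hand-off item (1) («F1 retirement», recipe INBOX 2026-08-28T05:55Z;
director g2 BATCH 22/24 on-call).  Theorems only, debt 0.
-/

noncomputable section

open Function MulAction Topology NumberField IsDedekindDomain CategoryTheory CategoryTheory.Limits Matrix
open scoped Matrix ComplexOrder
open Literature.AlgebraicGeometry.Motives
open Literature.NumberTheory.Automorphic Literature.NumberTheory.Automorphic.UnitaryGroup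
open Literature.NumberTheory.Automorphic.ShimuraDissection
open Literature.NumberTheory.Automorphic.Liu2021.AppendixC (C5.OpenCompactSubgroup C5.SmallLevel)
open Literature.Geometry.ComplexHyperbolic Literature.Geometry.ComplexHyperbolic.BallModel
open Literature.NumberTheory.ComplexMultiplication (traceField reflexNormFiniteIdele)

namespace Literature.AlgebraicGeometry.ShimuraVarieties

namespace UnitaryCanonicalModel

namespace Aux

/-- **F1 from the twisted fact.**  `Aux.canonicalModel_exists_ext_printed → Aux.canonicalModel_exists_printed`: F1 is the instance
`M = L`, `j = id`, `Φ` adapted at `τ`, `E = E♯(Φ) = τ(L)·E*(Φ)` (Deligne 2.2.5: the canonical model over `E(G̃, X̃) = E♯(Φ)` is in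
particular a weakly canonical model over `E♯(Φ)`; here both sides are the SAME typed statement, the Ext carriers reducing to the
`UnitaryAuxiliaryTorusDatum` carriers definitionally).
[cite: Deligne1979ShimuraVarieties, Criterion 2.3.1 and 2.2.4–2.2.5 (PDF p. 29 of Milne's translation)]
[cite: Milne2005ShimuraVarieties, Def. 12.8 (62) p. 114; Rem. 12.9 p. 115] [cite: Liu2021, App. C §C.3 pp. 113–114 (Lem. C.14, (C.6))] -/
theorem canonicalModel_exists_printed_of_ext (hExt : canonicalModel_exists_ext_printed) : canonicalModel_exists_printed := by
  intro L _ _ _ H τ T hT hpos hanis K₀ htf Sc Φ hΦ L₀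
  haveI : FiniteDimensional ℚ ↥(reflexField L Φ τ) := (numberField_reflexField L Φ τ).to_finiteDimensional
  obtain ⟨N, ρ, e, hρ, he, hdesc⟩ := hExt L H τ T hT hpos hanis K₀ htf Sc L (RingHom.id L) Φ
    ((isExtAdapted_id_iff τ Φ).2 hΦ) (reflexField L Φ τ) (apply_mem_reflexField L Φ τ) (traceField_le_reflexField L Φ τ) L₀
  exact ⟨N, ρ, e, hρ, he, (isCanonicalDescentAtExt_self_iff Φ L₀ Sc N e).1 hdesc⟩

end Aux

end UnitaryCanonicalModel

end Literature.AlgebraicGeometry.ShimuraVarieties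

end
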